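import Summits.CriticalPhenomena.PercolationContinuityZ3.Theorems.PercNearOneGluingNoHeavyLowerTailSahiThreeCopyTwoPointCerts
import Summits.CriticalPhenomena.PercolationContinuityZ3.Theorems.PercNearOneGluingNoHeavyLowerTailSahiThreeCopyCumulationSlot

/-!
# Sahi's three-function conjecture — sandwich certificates: a fast exact checker, its bridge, and relabelling

Infrastructure for certificate theorems on `{0,1}^k` beyond `k = 3` (companion of `…SahiThreeCopyTwoPointCerts`).

* §1 A fast exact checker `certOKfastZ`.  The forms `(N1), (N2)` of the two-point reduction theorem are bilinear in the indicator
  vectors `1_V, 1_W`, so it suffices to tabulate them at singletons (two `2^k × 2^k` integer matrices, all weights scaled by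
  `S` so that `S·θ` is integral) and to test `1_Vᵀ K 1_W ≥ 0` over all pairs of up-sets by row sums and bitmask sums.  The
  bounded quantifier over the family of up-sets is pinned to element iteration (`allMem`): the default instance would
  enumerate the whole power set.
* §2 The bridge: bilinearity of `N1C`, `N2C`, bitmask sums, the cast from the integer check to the rational facts, and from
  the facts to `0 ≤ c_{(π,b)}(1_A ∘ front, G, H)` in all dimensions (`tc_frontFn_nonneg_of_facts`).
* §3 Relabelling: the facts for `(π₀, A₀)` give the conclusion for every `(π₀ ∘ σ, A₀ ∘ σ)`, `σ ∈ S_k`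
  (`tc_frontFn_nonneg_of_relab`), so a certificate table needs one entry per `S_k`-orbit.
-/

namespace Summit.CriticalPhenomena.PercolationContinuityZ3.Theorems.SahiThreeCopy

open Finset Function Literature.Combinatorics.Sahi2008
open scoped BigOperators

/-! ### §1 The fast integer checker -/

section Fast

variable {k : ℕ}

/-- Integer indicator of membership. [this work] -/
def mZ (V : Finset (Fin (2 ^ k))) (x : Fin (2 ^ k)) : ℤ := if x ∈ V then 1 else 0

/-- Scaled weights `S·θ` read off an integer table. [this work] -/
def thetaZ (tab : Array ℤ) (x : Fin (2 ^ k)) : ℤ := tab.getD (x : ℕ) 0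

/-- `S · (N1)` on indicators with integer weights `S·θ`. [this work] -/
def N1Z (S : ℕ) (A : Finset (Fin (2 ^ k) × Fin (2 ^ k) × Fin (2 ^ k))) (F : Finset (Fin (2 ^ k))) (tab : Array ℤ)
    (V W : Finset (Fin (2 ^ k))) : ℤ :=
  ∑ σ ∈ A, ((2 * S * mZ F σ.1 - thetaZ tab σ.1) * (mZ V σ.1 * mZ W σ.1) - S * mZ F σ.1 * (mZ V σ.2.1 * mZ W σ.2.1))

/-- `S · (N2)` on indicators with integer weights `S·θ`. [this work] -/
def N2Z (S : ℕ) (A : Finset (Fin (2 ^ k) × Fin (2 ^ k) × Fin (2 ^ k))) (F : Finset (Fin (2 ^ k))) (tab : Array ℤ)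
    (V W : Finset (Fin (2 ^ k))) : ℤ :=
  ∑ σ ∈ A, (thetaZ tab σ.1 * (mZ V σ.1 * mZ W σ.1) + S * mZ F σ.1 * (mZ V σ.2.1 * mZ W σ.2.2)
    - S * mZ F σ.2.1 * (mZ V σ.1 * mZ W σ.2.1) - S * mZ F σ.2.1 * (mZ V σ.2.1 * mZ W σ.1))

/-- The `(N1)` kernel at singletons, tabulated. [this work] -/
def kmat1 (S : ℕ) (A : Finset (Fin (2 ^ k) × Fin (2 ^ k) × Fin (2 ^ k))) (F : Finset (Fin (2 ^ k))) (tab : Array ℤ) :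
    Vector (Vector ℤ (2 ^ k)) (2 ^ k) :=
  Vector.ofFn fun x => Vector.ofFn fun y => N1Z S A F tab {x} {y}

/-- The `(N2)` kernel at singletons, tabulated. [this work] -/
def kmat2 (S : ℕ) (A : Finset (Fin (2 ^ k) × Fin (2 ^ k) × Fin (2 ^ k))) (F : Finset (Fin (2 ^ k))) (tab : Array ℤ) :
    Vector (Vector ℤ (2 ^ k)) (2 ^ k) :=
  Vector.ofFn fun x => Vector.ofFn fun y => N2Z S A F tab {x} {y}

/-- Row sums of a kernel over `V`. [this work] -/
def rowSum (K : Vector (Vector ℤ (2 ^ k)) (2 ^ k)) (V : Finset (Fin (2 ^ k))) : Array ℤ :=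
  Array.ofFn fun y : Fin (2 ^ k) => ∑ x ∈ V, (K[x])[y]

/-- Bitmask of a family of codes (bit `y` set iff `y ∈ W`). [this work] -/
def maskOf (W : Finset (Fin (2 ^ k))) : ℕ := (finFunctionFinEquiv fun y : Fin (2 ^ k) => (if y ∈ W then 1 else 0 : Fin 2) : ℕ)

/-- `Σ_{i < n, bit i of m set} r[i]` (a loop). [this work] -/
def sumBits (r : Array ℤ) (m : ℕ) : ℕ → ℤ
  | 0 => 0
  | i + 1 => sumBits r m i + if m.testBit i then r.getD i 0 else 0

/-- `decide (∀ W ∈ U, p W)` computed by iterating the elements of `U` (the instance is pinned: the default search picks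
`Fintype.decidableForallFintype` when the element type is finite and enumerates the whole ambient type). [this work] -/
def allMem {α : Type*} (U : Finset α) (p : α → Bool) : Bool :=
  @decide (∀ W ∈ U, p W = true) (@Finset.decidableDforallFinset α U (fun W _ => p W = true) fun _ _ => inferInstance)

/-- Specification of `allMem`. [this work] -/
theorem allMem_eq_true {α : Type*} {U : Finset α} {p : α → Bool} : allMem U p = true ↔ ∀ W ∈ U, p W = true := by
  unfold allMem; exact decide_eq_true_iff

/-- Inner check for one `V`: for all masks `m ∈ UM`, both pair sums are `≥ 0`. [this work] -/
def rowOK (K1 K2 : Vector (Vector ℤ (2 ^ k)) (2 ^ k)) (UM : Finset ℕ) (V : Finset (Fin (2 ^ k))) : Bool :=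
  let r1 := rowSum K1 V
  let r2 := rowSum K2 V
  allMem UM fun m => decide (0 ≤ sumBits r1 m (2 ^ k)) && decide (0 ≤ sumBits r2 m (2 ^ k))

/-- The fast certificate check (scale `S`; `UM` = the masks of `U`): `S·θ ≥ 0` entrywise and both bilinear forms `≥ 0` on all
pairs from `U`. [this work] -/
def certOKfastZ (S : ℕ) (A : Finset (Fin (2 ^ k) × Fin (2 ^ k) × Fin (2 ^ k))) (U : Finset (Finset (Fin (2 ^ k))))
    (UM : Finset ℕ) (F : Finset (Fin (2 ^ k))) (tab : Array ℤ) : Bool :=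
  let K1 := kmat1 S A F tab
  let K2 := kmat2 S A F tab
  decide (∀ x : Fin (2 ^ k), 0 ≤ thetaZ tab x) && allMem U fun V => rowOK K1 K2 UM V

end Fast

/-! ### §2 Bridge: bilinearity, bitmask sums, casts -/

section Bridge

variable {k : ℕ}

/-- `mC V z = Σ_{x ∈ V} mC {x} z`. [this work] -/
theorem mC_eq_sum (V : Finset (Fin (2 ^ k))) (z : Fin (2 ^ k)) : mC V z = ∑ x ∈ V, mC {x} z := by
  unfold mC
  simp only [Finset.mem_singleton]
  by_cases h : z ∈ V
  · rw [if_pos h, Finset.sum_eq_single_of_mem z h (fun x _ hx => if_neg (Ne.symm hx)), if_pos rfl]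
  · rw [if_neg h]; symm; exact Finset.sum_eq_zero fun x (hx : x ∈ V) => if_neg (fun hzx : z = x => h (hzx ▸ hx))

/-- Bilinear expansion of a product of membership indicators. [this work] -/
theorem mC_mul_mC (V W : Finset (Fin (2 ^ k))) (a b : Fin (2 ^ k)) :
    mC V a * mC W b = ∑ x ∈ V, ∑ y ∈ W, mC {x} a * mC {y} b := by
  rw [mC_eq_sum V a, mC_eq_sum W b, Finset.sum_mul]
  exact Finset.sum_congr rfl fun x _ => Finset.mul_sum _ _ _

/-- Triple sums: moving the innermost sum out (plumbing). [folklore] -/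
theorem sum_sum_sum_comm {α β γ : Type*} (s : Finset α) (t : Finset β) (u : Finset γ) (g : α → β → γ → ℚ) :
    ∑ a ∈ s, ∑ b ∈ t, ∑ c ∈ u, g a b c = ∑ c ∈ u, ∑ a ∈ s, ∑ b ∈ t, g a b c := by
  have h1 : ∀ a ∈ s, ∑ b ∈ t, ∑ c ∈ u, g a b c = ∑ c ∈ u, ∑ b ∈ t, g a b c := fun a _ => Finset.sum_comm
  rw [Finset.sum_congr rfl h1, Finset.sum_comm]

/-- `N1C` at `(V,W)` is the double sum of its values at singletons (bilinearity). [this work] -/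
theorem N1C_eq_sum_singleton (A : Finset (Fin (2 ^ k) × Fin (2 ^ k) × Fin (2 ^ k))) (F : Finset (Fin (2 ^ k))) (tab : Array ℚ)
    (V W : Finset (Fin (2 ^ k))) : N1C A F tab V W = ∑ x ∈ V, ∑ y ∈ W, N1C A F tab {x} {y} := by
  have pt : ∀ σ : Fin (2 ^ k) × Fin (2 ^ k) × Fin (2 ^ k),
      ((2 * mC F σ.1 - thetaC tab σ.1) * (mC V σ.1 * mC W σ.1) - mC F σ.1 * (mC V σ.2.1 * mC W σ.2.1)) =
        ∑ x ∈ V, ∑ y ∈ W, ((2 * mC F σ.1 - thetaC tab σ.1) * (mC {x} σ.1 * mC {y} σ.1) - mC F σ.1 * (mC {x} σ.2.1 * mC {y} σ.2.1)) := by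
    intro σ
    rw [mC_mul_mC V W σ.1 σ.1, mC_mul_mC V W σ.2.1 σ.2.1, Finset.mul_sum, Finset.mul_sum, ← Finset.sum_sub_distrib]
    refine Finset.sum_congr rfl fun x _ => ?_
    rw [Finset.mul_sum, Finset.mul_sum, ← Finset.sum_sub_distrib]
  unfold N1C
  rw [Finset.sum_congr rfl fun σ _ => pt σ, ← sum_sum_sum_comm]

/-- `N2C` at `(V,W)` is the double sum of its values at singletons (bilinearity). [this work] -/
theorem N2C_eq_sum_singleton (A : Finset (Fin (2 ^ k) × Fin (2 ^ k) × Fin (2 ^ k))) (F : Finset (Fin (2 ^ k))) (tab : Array ℚ)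
    (V W : Finset (Fin (2 ^ k))) : N2C A F tab V W = ∑ x ∈ V, ∑ y ∈ W, N2C A F tab {x} {y} := by
  have pt : ∀ σ : Fin (2 ^ k) × Fin (2 ^ k) × Fin (2 ^ k),
      (thetaC tab σ.1 * (mC V σ.1 * mC W σ.1) + mC F σ.1 * (mC V σ.2.1 * mC W σ.2.2)
        - mC F σ.2.1 * (mC V σ.1 * mC W σ.2.1) - mC F σ.2.1 * (mC V σ.2.1 * mC W σ.1)) =
        ∑ x ∈ V, ∑ y ∈ W, (thetaC tab σ.1 * (mC {x} σ.1 * mC {y} σ.1) + mC F σ.1 * (mC {x} σ.2.1 * mC {y} σ.2.2)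
          - mC F σ.2.1 * (mC {x} σ.1 * mC {y} σ.2.1) - mC F σ.2.1 * (mC {x} σ.2.1 * mC {y} σ.1)) := by
    intro σ
    rw [mC_mul_mC V W σ.1 σ.1, mC_mul_mC V W σ.2.1 σ.2.2, mC_mul_mC V W σ.1 σ.2.1, mC_mul_mC V W σ.2.1 σ.1]
    simp only [Finset.mul_sum, ← Finset.sum_sub_distrib, ← Finset.sum_add_distrib]
  unfold N2C
  rw [Finset.sum_congr rfl fun σ _ => pt σ, ← sum_sum_sum_comm]

/-- Bits of the mask are membership. [this work] -/
theorem testBit_maskOf (W : Finset (Fin (2 ^ k))) (y : Fin (2 ^ k)) : (maskOf W).testBit (y : ℕ) = decide (y ∈ W) := by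
  have h1 := finFunctionFinEquiv_symm_apply_val
    (finFunctionFinEquiv fun y : Fin (2 ^ k) => (if y ∈ W then 1 else 0 : Fin 2)) y
  rw [Equiv.symm_apply_apply] at h1
  unfold maskOf
  rw [Nat.testBit_eq_decide_div_mod_eq, ← h1]
  by_cases h : y ∈ W <;> simp [h]

/-- The loop `sumBits` is a sum over `range`. [this work] -/
theorem sumBits_eq (r : Array ℤ) (m : ℕ) : ∀ n, sumBits r m n = ∑ i ∈ Finset.range n, if m.testBit i then r.getD i 0 else 0
  | 0 => by simp [sumBits]
  | n + 1 => by rw [sumBits, sumBits_eq r m n, Finset.sum_range_succ]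

/-- Bitmask sums over the mask of `W` are sums over `W`. [this work] -/
theorem sumBits_maskOf (r : Array ℤ) (W : Finset (Fin (2 ^ k))) :
    sumBits r (maskOf W) (2 ^ k) = ∑ y ∈ W, r.getD (y : ℕ) 0 := by
  rw [sumBits_eq, ← Fin.sum_univ_eq_sum_range (fun i => if (maskOf W).testBit i then r.getD i 0 else 0) (2 ^ k)]
  simp only [testBit_maskOf, decide_eq_true_eq]
  rw [← Finset.sum_filter, Finset.filter_mem_eq_inter, Finset.univ_inter]

/-- Reading a row sum. [this work] -/
theorem rowSum_getD (K : Vector (Vector ℤ (2 ^ k)) (2 ^ k)) (V : Finset (Fin (2 ^ k))) (y : Fin (2 ^ k)) :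
    (rowSum K V).getD (y : ℕ) 0 = ∑ x ∈ V, (K[x])[y] := by
  unfold rowSum
  have hy : (y : ℕ) < (Array.ofFn fun y : Fin (2 ^ k) => ∑ x ∈ V, (K[x])[y]).size := by rw [Array.size_ofFn]; exact y.isLt
  rw [Array.getD_eq_getD_getElem?, Array.getElem?_eq_getElem hy, Option.getD_some, Array.getElem_ofFn]

/-- The rational weight table `θ = (S·θ)/S` attached to an integer table. [this work] -/
def tabQof (S : ℕ) (k : ℕ) (tab : Array ℤ) : Array ℚ := Array.ofFn fun x : Fin (2 ^ k) => (((tab.getD (x : ℕ) 0 : ℤ) : ℚ)) / S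

/-- Reading the rational table. [this work] -/
theorem thetaC_tabQof (S : ℕ) (tab : Array ℤ) (x : Fin (2 ^ k)) : thetaC (tabQof S k tab) x = ((thetaZ tab x : ℤ) : ℚ) / S := by
  unfold thetaC tabQof thetaZ
  have hx : (x : ℕ) < (Array.ofFn fun x : Fin (2 ^ k) => (((tab.getD (x : ℕ) 0 : ℤ) : ℚ)) / S).size := by
    rw [Array.size_ofFn]; exact x.isLt
  rw [Array.getD_eq_getD_getElem?, Array.getElem?_eq_getElem hx, Option.getD_some, Array.getElem_ofFn]

/-- Cast of the integer indicator. [this work] -/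
theorem cast_mZ (V : Finset (Fin (2 ^ k))) (x : Fin (2 ^ k)) : ((mZ V x : ℤ) : ℚ) = mC V x := by
  unfold mZ mC; split_ifs <;> simp

/-- `N1Z = S · N1C` (with `θ = (S·θ)/S`). [this work] -/
theorem cast_N1Z {S : ℕ} (hS : 0 < S) (A : Finset (Fin (2 ^ k) × Fin (2 ^ k) × Fin (2 ^ k))) (F : Finset (Fin (2 ^ k)))
    (tab : Array ℤ) (V W : Finset (Fin (2 ^ k))) :
    ((N1Z S A F tab V W : ℤ) : ℚ) = S * N1C A F (tabQof S k tab) V W := by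
  unfold N1Z N1C
  push_cast
  rw [Finset.mul_sum]
  refine Finset.sum_congr rfl fun σ _ => ?_
  have hS' : (S : ℚ) ≠ 0 := by exact_mod_cast hS.ne'
  simp only [thetaC_tabQof, cast_mZ]
  field_simp

/-- `N2Z = S · N2C` (with `θ = (S·θ)/S`). [this work] -/
theorem cast_N2Z {S : ℕ} (hS : 0 < S) (A : Finset (Fin (2 ^ k) × Fin (2 ^ k) × Fin (2 ^ k))) (F : Finset (Fin (2 ^ k)))
    (tab : Array ℤ) (V W : Finset (Fin (2 ^ k))) :
    ((N2Z S A F tab V W : ℤ) : ℚ) = S * N2C A F (tabQof S k tab) V W := by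
  unfold N2Z N2C
  push_cast
  rw [Finset.mul_sum]
  refine Finset.sum_congr rfl fun σ _ => ?_
  have hS' : (S : ℚ) ≠ 0 := by exact_mod_cast hS.ne'
  simp only [thetaC_tabQof, cast_mZ]
  field_simp

/-- ★ Unpacking the fast integer check into the rational facts `θ ≥ 0`, `(N1), (N2) ≥ 0` on `U × U`. [this work] -/
theorem facts_of_certOKfastZ {S : ℕ} (hS : 0 < S) {A : Finset (Fin (2 ^ k) × Fin (2 ^ k) × Fin (2 ^ k))}
    {U : Finset (Finset (Fin (2 ^ k)))} {F : Finset (Fin (2 ^ k))} {tab : Array ℤ}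
    (h : certOKfastZ S A U (U.image maskOf) F tab = true) :
    (∀ x : Fin (2 ^ k), 0 ≤ thetaC (tabQof S k tab) x) ∧
      (∀ V ∈ U, ∀ W ∈ U, 0 ≤ N1C A F (tabQof S k tab) V W ∧ 0 ≤ N2C A F (tabQof S k tab) V W) := by
  unfold certOKfastZ at h
  rw [Bool.and_eq_true, decide_eq_true_eq, allMem_eq_true] at h
  have hSq : (0 : ℚ) < S := by exact_mod_cast hS
  refine ⟨fun x => ?_, fun V hV W hW => ?_⟩
  · rw [thetaC_tabQof]; exact div_nonneg (by exact_mod_cast h.1 x) hSq.le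
  have hr := h.2 V hV
  unfold rowOK at hr
  rw [allMem_eq_true] at hr
  have hW' := hr (maskOf W) (Finset.mem_image_of_mem _ hW)
  rw [Bool.and_eq_true, decide_eq_true_eq, decide_eq_true_eq, sumBits_maskOf, sumBits_maskOf] at hW'
  simp only [rowSum_getD, kmat1, kmat2, Fin.getElem_fin, Vector.getElem_ofFn, Fin.eta] at hW'
  obtain ⟨h1, h2⟩ := hW'
  have h1' : (0 : ℚ) ≤ S * N1C A F (tabQof S k tab) V W := by
    rw [N1C_eq_sum_singleton, Finset.sum_comm, Finset.mul_sum]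
    have h1c : (0 : ℚ) ≤ ((∑ y ∈ W, ∑ x ∈ V, N1Z S A F tab {x} {y} : ℤ) : ℚ) := by exact_mod_cast h1
    rw [Int.cast_sum] at h1c
    refine h1c.trans_eq (Finset.sum_congr rfl fun y _ => ?_)
    rw [Int.cast_sum, Finset.mul_sum]
    exact Finset.sum_congr rfl fun x _ => cast_N1Z hS A F tab {x} {y}
  have h2' : (0 : ℚ) ≤ S * N2C A F (tabQof S k tab) V W := by
    rw [N2C_eq_sum_singleton, Finset.sum_comm, Finset.mul_sum]
    have h2c : (0 : ℚ) ≤ ((∑ y ∈ W, ∑ x ∈ V, N2Z S A F tab {x} {y} : ℤ) : ℚ) := by exact_mod_cast h2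
    rw [Int.cast_sum] at h2c
    refine h2c.trans_eq (Finset.sum_congr rfl fun y _ => ?_)
    rw [Int.cast_sum, Finset.mul_sum]
    exact Finset.sum_congr rfl fun x _ => cast_N2Z hS A F tab {x} {y}
  exact ⟨(mul_nonneg_iff_of_pos_left hSq).1 h1', (mul_nonneg_iff_of_pos_left hSq).1 h2'⟩

/-- From the rational facts to 3C in all dimensions (the two-point reduction theorem, coded). [this work] -/
theorem tc_frontFn_nonneg_of_facts (π : Fin k → ℕ) (A : Finset (Pt k)) (tab : Array ℚ) (h0 : ∀ x : Fin (2 ^ k), 0 ≤ thetaC tab x)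
    (h12 : ∀ V ∈ upSetsC k, ∀ W ∈ upSetsC k,
      0 ≤ N1C (arrSetC π) (A.map (codeE k).toEmbedding) tab V W ∧ 0 ≤ N2C (arrSetC π) (A.map (codeE k).toEmbedding) tab V W)
    {d : ℕ} (b : Fin d → ℕ) {G H : Pt (d + k) → ℝ} (hG : ∀ w, 0 ≤ G w) (hH : ∀ w, 0 ≤ H w) (hGm : Monotone G) (hHm : Monotone H) :
    0 ≤ tc (appendProf k π b) (frontFn k (setInd A)) G H := by
  refine tc_frontFn_nonneg_of_upSets k π (setInd A) (fun a _ _ => (thetaC tab (codeE k a) : ℝ)) (fun e₁ _ _ => ?_) ?_ ?_ b hG hH hGm hHm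
  · exact_mod_cast h0 (codeE k e₁)
  · intro V W hV hW
    rw [N1form_eq_N1C]
    exact_mod_cast (h12 _ (map_mem_upSetsC hV) _ (map_mem_upSetsC hW)).1
  · intro V W hV hW
    rw [N2form_eq_N2C]
    exact_mod_cast (h12 _ (map_mem_upSetsC hV) _ (map_mem_upSetsC hW)).2

end Bridge

/-! ### §3 Relabelling the front coordinates -/

section Relab

variable {k : ℕ}

/-- Relabelling of codes: new digit `i` = old digit `σ i`. [this work] -/
def permCode (σ : Fin k → Fin k) (x : Fin (2 ^ k)) : Fin (2 ^ k) := finFunctionFinEquiv fun i => finFunctionFinEquiv.symm x (σ i)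

/-- Coding commutes with relabelling. [this work] -/
theorem codeE_relab (σ : Equiv.Perm (Fin k)) (e : Pt k) : codeE k (relab σ e) = permCode σ (codeE k e) := by
  unfold codeE permCode
  simp only [Equiv.trans_apply, Equiv.symm_apply_apply, Equiv.arrowCongr_apply, Equiv.refl_symm, Equiv.coe_refl,
    Function.comp_apply, relab_apply, id_eq]
  rfl

/-- The code image of a relabelled set. [this work] -/
theorem map_relab_codeE (σ : Equiv.Perm (Fin k)) (A : Finset (Pt k)) :
    (A.map (relab σ).toEmbedding).map (codeE k).toEmbedding = (A.map (codeE k).toEmbedding).image (permCode σ) := by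
  ext x
  simp only [Finset.mem_map, Finset.mem_image, Equiv.coe_toEmbedding]
  constructor
  · rintro ⟨e', ⟨e, he, rfl⟩, rfl⟩; exact ⟨codeE k e, ⟨e, he, rfl⟩, (codeE_relab σ e).symm⟩
  · rintro ⟨y, ⟨e, he, rfl⟩, rfl⟩; exact ⟨relab σ e, ⟨e, he, rfl⟩, codeE_relab σ e⟩

/-- The arrangement indicator is relabelling-invariant. [this work] -/
theorem arrInd_relab (σ : Equiv.Perm (Fin k)) (π : Fin k → ℕ) (x y z : Pt k) :
    arrInd (π ∘ σ) (relab σ x) (relab σ y) (relab σ z) = arrInd π x y z := by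
  unfold arrInd
  simp only [relab_apply, isArr_relab]

/-- Relabelling identity for (N1) (weights depending on the first level only). [this work] -/
theorem N1form_relab (σ : Equiv.Perm (Fin k)) (π : Fin k → ℕ) (f g φ ψ : Pt k → ℝ) :
    N1form k (π ∘ σ) f (fun a _ _ => g ((relab σ).symm a)) φ ψ =
      N1form k π (f ∘ relab σ) (fun a _ _ => g a) (φ ∘ relab σ) (ψ ∘ relab σ) := by
  unfold N1form
  rw [← Equiv.sum_comp ((relab σ).prodCongr ((relab σ).prodCongr (relab σ)))]
  refine Finset.sum_congr rfl fun τ _ => ?_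
  simp only [Equiv.prodCongr_apply, Prod.map_fst, Prod.map_snd, Function.comp_apply, Equiv.symm_apply_apply, arrInd_relab]

/-- Relabelling identity for (N2) (weights depending on the first level only). [this work] -/
theorem N2form_relab (σ : Equiv.Perm (Fin k)) (π : Fin k → ℕ) (f g φ ψ : Pt k → ℝ) :
    N2form k (π ∘ σ) f (fun a _ _ => g ((relab σ).symm a)) φ ψ =
      N2form k π (f ∘ relab σ) (fun a _ _ => g a) (φ ∘ relab σ) (ψ ∘ relab σ) := by
  unfold N2form
  rw [← Equiv.sum_comp ((relab σ).prodCongr ((relab σ).prodCongr (relab σ)))]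
  refine Finset.sum_congr rfl fun τ _ => ?_
  simp only [Equiv.prodCongr_apply, Prod.map_fst, Prod.map_snd, Function.comp_apply, Equiv.symm_apply_apply, arrInd_relab]

/-- Indicator of a relabelled set, pulled back. [this work] -/
theorem setInd_map_comp_relab (σ : Equiv.Perm (Fin k)) (X : Finset (Pt k)) :
    setInd (X.map (relab σ).toEmbedding) ∘ relab σ = setInd X := by
  funext e
  unfold setInd
  simp only [Function.comp_apply, Finset.mem_map_equiv, Equiv.symm_apply_apply]

/-- Pull-back of an indicator along a relabelling. [this work] -/
theorem setInd_comp_relab (σ : Equiv.Perm (Fin k)) (V : Finset (Pt k)) :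
    setInd V ∘ relab σ = setInd (V.map (relab σ).symm.toEmbedding) := by
  funext e
  unfold setInd
  simp only [Function.comp_apply, Finset.mem_map_equiv, Equiv.symm_symm]

/-- Relabelled up-sets are up-sets. [this work] -/
theorem isUpperSet_map_relab_symm (σ : Equiv.Perm (Fin k)) {V : Finset (Pt k)} (hV : IsUpperSet (V : Set (Pt k))) :
    IsUpperSet ((V.map (relab σ).symm.toEmbedding : Finset (Pt k)) : Set (Pt k)) := by
  intro x y hxy hx
  rw [Finset.mem_coe, Finset.mem_map_equiv, Equiv.symm_symm] at hx ⊢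
  exact hV (relab_monotone σ hxy) hx

/-- ★ **Relabelling transfer.**  If the coded facts hold for `(π₀, A₀)` then `0 ≤ c_{(π,b)}(1_A ∘ front, G, H)` for
`π = π₀ ∘ σ`, `A = A₀ ∘ σ` (any `σ ∈ S_k`), every back profile `b` on a cube of any dimension and all nonnegative monotone
`G, H`. [this work] -/
theorem tc_frontFn_nonneg_of_relab (σ : Equiv.Perm (Fin k)) (π₀ : Fin k → ℕ) (A₀ : Finset (Pt k)) (tab : Array ℚ)
    (h0 : ∀ x : Fin (2 ^ k), 0 ≤ thetaC tab x)
    (h12 : ∀ V ∈ upSetsC k, ∀ W ∈ upSetsC k,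
      0 ≤ N1C (arrSetC π₀) (A₀.map (codeE k).toEmbedding) tab V W ∧ 0 ≤ N2C (arrSetC π₀) (A₀.map (codeE k).toEmbedding) tab V W)
    {π : Fin k → ℕ} (hπ : π = π₀ ∘ σ) {A : Finset (Pt k)} (hA : A = A₀.map (relab σ).toEmbedding)
    {d : ℕ} (b : Fin d → ℕ) {G H : Pt (d + k) → ℝ} (hG : ∀ w, 0 ≤ G w) (hH : ∀ w, 0 ≤ H w) (hGm : Monotone G) (hHm : Monotone H) :
    0 ≤ tc (appendProf k π b) (frontFn k (setInd A)) G H := by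
  subst hπ hA
  refine tc_frontFn_nonneg_of_upSets k (π₀ ∘ σ) (setInd (A₀.map (relab σ).toEmbedding))
    (fun a _ _ => (fun a' => (thetaC tab (codeE k a') : ℝ)) ((relab σ).symm a)) (fun e₁ _ _ => ?_) ?_ ?_ b hG hH hGm hHm
  · show (0 : ℝ) ≤ (thetaC tab (codeE k ((relab σ).symm e₁)) : ℝ)
    exact_mod_cast h0 (codeE k ((relab σ).symm e₁))
  · intro V W hV hW
    rw [N1form_relab σ π₀ _ (fun a' => (thetaC tab (codeE k a') : ℝ)), setInd_map_comp_relab, setInd_comp_relab σ V, setInd_comp_relab σ W, N1form_eq_N1C]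
    exact_mod_cast (h12 _ (map_mem_upSetsC (isUpperSet_map_relab_symm σ hV)) _
      (map_mem_upSetsC (isUpperSet_map_relab_symm σ hW))).1
  · intro V W hV hW
    rw [N2form_relab σ π₀ _ (fun a' => (thetaC tab (codeE k a') : ℝ)), setInd_map_comp_relab, setInd_comp_relab σ V, setInd_comp_relab σ W, N2form_eq_N2C]
    exact_mod_cast (h12 _ (map_mem_upSetsC (isUpperSet_map_relab_symm σ hV)) _
      (map_mem_upSetsC (isUpperSet_map_relab_symm σ hW))).2

end Relab

end Summit.CriticalPhenomena.PercolationContinuityZ3.Theorems.SahiThreeCopy
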